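import Summits.Ventures.YMGap.RobustBall.StarFarEnergyZd
import Summits.Ventures.YMGap.RobustBall.StarDoorZdW
import HarnessLib

/-!
# Venture YMGap, track ROBUST-BALL (Y2) — crux Y2-X2-WZd, step 3: far LOADS of a member of the diameter-weighted
# ball at a vertex star, the sitewise-to-global window contraction, and two elementary inequalities

HONEST FRAMING. WHAT THIS IS: a venture file (cell `pub-ymgap`, track Y2 ROBUST-BALL, seat ds-2); bookkeeping for
the tier-2 `ℤ^d` star door (`RobustStarDoorZdW.lean`):
* for `W ∈ MemBallZdW κ ε₀ ε₁` (`κ ≥ 0`), a vertex `s` and a box radius `D`, with the far family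
  `FAR = {X : X ∩ ⋆_s ≠ ∅, X ⊄ starNbhdZdR D s}` (every far set has diameter `≥ D`): the star-link constants
  `ℓ_x = Σ'_{FAR ∋ x} lip_X(x)` are summable with `Σ_{x ∈ ⋆} ℓ_x ≤ (d+1) e^{−κD} ε₁` (`sum_star_farLip_le`), and the
  exterior constants `L_y = Σ'_{FAR ∋ y, y ∉ ⋆} lip_X(y)` have the reach-weighted sum
  `Σ'_y L_y e^{t(‖y.1−s‖+1)} ≤ (d+1) e^{2t} e^{−(κ−t)D} ε₁` for `0 ≤ t ≤ κ` (`tsum_farExt_mul_exp_reach_le`);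
* `window_contraction_global_of_sitewise` — a SITEWISE one-boundary-link window contraction with an array
  supported in a finite locality set, plus locality of the kernel, gives the GLOBAL form (all pairs of
  exteriors) by changing the boundary links one at a time;
* `abs_exp_sub_exp_le`, `abs_div_sub_div_le` — the two real inequalities of the tilt comparison.
WHAT THIS IS NOT: no door, no number; nothing about the continuum or the Millennium problem.
-/

noncomputable section

open MeasureTheory Function Finset Real
open scoped NNReal
open Literature.Probability.LatticeModels
open Literature.Probability.LatticeModels.DobrushinMetric
open Literature.MathematicalPhysics.QuantumLattice
open Literature.MathematicalPhysics.QuantumFieldTheory hiding ZdEdge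
open Summit.Ventures.YMGap.DSWindowZd

namespace Summit.Ventures.YMGap.RobustBall

variable {d N : ℕ}

/-! ### Two real inequalities -/

/-- `|e^a − e^b| ≤ e^τ |a − b|` for `a, b ≤ τ`. [folklore] -/
theorem abs_exp_sub_exp_le {a b τ : ℝ} (ha : a ≤ τ) (hb : b ≤ τ) : |exp a - exp b| ≤ exp τ * |a - b| := by
  -- `e^y − e^x ≤ e^y (y − x)` for `x ≤ y`, from `1 − (y − x) ≤ e^{−(y−x)}`
  have key : ∀ x y : ℝ, x ≤ y → y ≤ τ → exp y - exp x ≤ exp τ * (y - x) := by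
    intro x y hxy hyτ
    have h1 : -(y - x) + 1 ≤ exp (-(y - x)) := Real.add_one_le_exp _
    have h2 : exp y - exp x = exp y * (1 - exp (-(y - x))) := by
      rw [mul_sub, mul_one, ← Real.exp_add]; ring_nf
    rw [h2]
    calc exp y * (1 - exp (-(y - x))) ≤ exp y * (y - x) :=
          mul_le_mul_of_nonneg_left (by linarith) (exp_pos _).le
      _ ≤ exp τ * (y - x) := mul_le_mul_of_nonneg_right (exp_le_exp.2 hyτ) (by linarith)
  rcases le_total a b with h | h
  · rw [abs_sub_comm, abs_of_nonneg (sub_nonneg.2 (exp_le_exp.2 h)), abs_sub_comm, abs_of_nonneg (sub_nonneg.2 h)]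
    exact key a b h hb
  · rw [abs_of_nonneg (sub_nonneg.2 (exp_le_exp.2 h)), abs_of_nonneg (sub_nonneg.2 h)]
    exact key b a h ha

/-- **The quotient inequality of the tilt comparison**: if `|a₁ − a₂| ≤ A`, `|b₁ − b₂| ≤ B`, `b_i ≥ e^{−τ}` and
`|a₂| ≤ e^τ F`, then `|a₁/b₁ − a₂/b₂| ≤ e^τ A + e^{3τ} F B`. [folklore] -/
theorem abs_div_sub_div_le {a₁ a₂ b₁ b₂ A B F τ : ℝ} (hA : |a₁ - a₂| ≤ A) (hB : |b₁ - b₂| ≤ B)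
    (hb₁ : exp (-τ) ≤ b₁) (hb₂ : exp (-τ) ≤ b₂) (ha₂ : |a₂| ≤ exp τ * F) :
    |a₁ / b₁ - a₂ / b₂| ≤ exp τ * A + exp (3 * τ) * F * B := by
  have hb₁0 : 0 < b₁ := lt_of_lt_of_le (exp_pos _) hb₁
  have hb₂0 : 0 < b₂ := lt_of_lt_of_le (exp_pos _) hb₂
  have hA0 : 0 ≤ A := (abs_nonneg _).trans hA
  have hB0 : 0 ≤ B := (abs_nonneg _).trans hB
  have hF' : 0 ≤ exp τ * F := (abs_nonneg _).trans ha₂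
  have hinv₁ : b₁⁻¹ ≤ exp τ := by
    rw [inv_le_comm₀ hb₁0 (exp_pos _), ← Real.exp_neg]; exact hb₁
  have hinv₂ : b₂⁻¹ ≤ exp τ := by
    rw [inv_le_comm₀ hb₂0 (exp_pos _), ← Real.exp_neg]; exact hb₂
  have hsplit : a₁ / b₁ - a₂ / b₂ = (a₁ - a₂) / b₁ + a₂ * (b₂ - b₁) / (b₁ * b₂) := by
    field_simp; ring
  rw [hsplit]
  refine (abs_add_le _ _).trans (add_le_add ?_ ?_)
  · rw [abs_div, abs_of_pos hb₁0, div_eq_mul_inv]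
    calc |a₁ - a₂| * b₁⁻¹ ≤ A * exp τ := mul_le_mul hA hinv₁ (inv_pos.2 hb₁0).le hA0
      _ = exp τ * A := mul_comm _ _
  · rw [abs_div, abs_mul, abs_of_pos (mul_pos hb₁0 hb₂0), abs_sub_comm, div_eq_mul_inv, mul_inv]
    have h3 : exp (3 * τ) = exp τ * (exp τ * exp τ) := by rw [← Real.exp_add, ← Real.exp_add]; ring_nf
    rw [h3]
    have hi0 : 0 ≤ b₁⁻¹ * b₂⁻¹ := mul_nonneg (inv_pos.2 hb₁0).le (inv_pos.2 hb₂0).le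
    have hi : b₁⁻¹ * b₂⁻¹ ≤ exp τ * exp τ := mul_le_mul hinv₁ hinv₂ (inv_pos.2 hb₂0).le (exp_pos _).le
    have h12 : |a₂| * |b₁ - b₂| ≤ (exp τ * F) * B := mul_le_mul ha₂ hB (abs_nonneg _) hF'
    calc |a₂| * |b₁ - b₂| * (b₁⁻¹ * b₂⁻¹) ≤ ((exp τ * F) * B) * (exp τ * exp τ) :=
          mul_le_mul h12 hi hi0 (mul_nonneg hF' hB0)
      _ = exp τ * (exp τ * exp τ) * F * B := by ring

/-! ### Far loads at a vertex star -/

section Loads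

variable {κ ε₁ : ℝ} {W : Potential (ZdEdge d) (SUN N)} {lip : Finset (ZdEdge d) → ZdEdge d → ℝ}

/-- Pointwise domination of a far star-link Lipschitz term by the weighted Lipschitz mass of the sets meeting
the star. [folklore] -/
theorem farLip_le_meets (hlip : ∀ X, IsLipBound suFrobDist (W X) (lip X)) (hκ : 0 ≤ κ) (D : ℕ) (s : Site d)
    (x : ZdEdge d) (X : Finset (ZdEdge d)) :
    (if ((X ∩ vertexStarZd s).Nonempty ∧ ¬ X ⊆ starNbhdZdR D s) ∧ x ∈ X then lip X x else 0) ≤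
      (if (X ∩ vertexStarZd s).Nonempty then Real.exp (κ * linkDiamZd X) * ∑ y ∈ X, lip X y else 0) := by
  have hs0 : 0 ≤ ∑ y ∈ X, lip X y := Finset.sum_nonneg fun y _ => (hlip X).nonneg y
  split_ifs with h1 h2 h2
  · calc lip X x ≤ ∑ y ∈ X, lip X y := Finset.single_le_sum (fun y _ => (hlip X).nonneg y) h1.2
      _ = 1 * ∑ y ∈ X, lip X y := (one_mul _).symm
      _ ≤ Real.exp (κ * linkDiamZd X) * ∑ y ∈ X, lip X y :=
          mul_le_mul_of_nonneg_right (Real.one_le_exp (mul_nonneg hκ (Nat.cast_nonneg _))) hs0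
  · exact absurd h1.1.1 h2
  · exact mul_nonneg (Real.exp_nonneg _) hs0
  · exact le_rfl

/-- **The far star-link constants `ℓ_x` are summable and `Σ_{x ∈ ⋆} ℓ_x ≤ (d+1) e^{−κD} ε₁`** (every far set has
diameter `≥ D`, site-incidence loads). [folklore] -/
theorem sum_star_farLip_le (hlip : ∀ X, IsLipBound suFrobDist (W X) (lip X))
    (hlips : ∀ v : Site d, Summable fun X : Finset (ZdEdge d) =>
      (if (∃ μ : Fin d, ((v, μ) : ZdEdge d) ∈ X) then Real.exp (κ * linkDiamZd X) * ∑ y ∈ X, lip X y else 0))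
    (hlipa : ∀ v : Site d, ∑' X : Finset (ZdEdge d),
      (if (∃ μ : Fin d, ((v, μ) : ZdEdge d) ∈ X) then Real.exp (κ * linkDiamZd X) * ∑ y ∈ X, lip X y else 0) ≤ ε₁)
    (hκ : 0 ≤ κ) (D : ℕ) (s : Site d) :
    (∀ x, Summable fun X : Finset (ZdEdge d) =>
      (if ((X ∩ vertexStarZd s).Nonempty ∧ ¬ X ⊆ starNbhdZdR D s) ∧ x ∈ X then lip X x else 0)) ∧
    ∑ x ∈ vertexStarZd s, ∑' X : Finset (ZdEdge d),
        (if ((X ∩ vertexStarZd s).Nonempty ∧ ¬ X ⊆ starNbhdZdR D s) ∧ x ∈ X then lip X x else 0) ≤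
      ((d : ℝ) + 1) * Real.exp (-(κ * D)) * ε₁ := by
  classical
  obtain ⟨hms, hmb⟩ := tsum_meets_star_weighted_lip_le (κ := κ) (ε₁ := ε₁) hlip hlips hlipa s
  have hnn : ∀ x X, 0 ≤ (if ((X ∩ vertexStarZd s).Nonempty ∧ ¬ X ⊆ starNbhdZdR D s) ∧ x ∈ X then lip X x else 0) :=
    fun x X => by split_ifs; exacts [(hlip X).nonneg x, le_rfl]
  have hsx : ∀ x, Summable fun X : Finset (ZdEdge d) =>
      (if ((X ∩ vertexStarZd s).Nonempty ∧ ¬ X ⊆ starNbhdZdR D s) ∧ x ∈ X then lip X x else 0) :=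
    fun x => Summable.of_nonneg_of_le (hnn x) (farLip_le_meets hlip hκ D s x) hms
  refine ⟨hsx, ?_⟩
  rw [← Summable.tsum_finsetSum (fun x _ => hsx x)]
  -- termwise: the star links of a far set carry at most `e^{-κD} e^{κ diam X} Σ lip`
  have hterm : ∀ X : Finset (ZdEdge d),
      ∑ x ∈ vertexStarZd s, (if ((X ∩ vertexStarZd s).Nonempty ∧ ¬ X ⊆ starNbhdZdR D s) ∧ x ∈ X then lip X x else 0)
        ≤ Real.exp (-(κ * D)) *
          (if (X ∩ vertexStarZd s).Nonempty then Real.exp (κ * linkDiamZd X) * ∑ y ∈ X, lip X y else 0) := by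
    intro X
    have hs0 : 0 ≤ ∑ y ∈ X, lip X y := Finset.sum_nonneg fun y _ => (hlip X).nonneg y
    by_cases hF : (X ∩ vertexStarZd s).Nonempty ∧ ¬ X ⊆ starNbhdZdR D s
    · rw [if_pos hF.1]
      obtain ⟨x₀, hx₀⟩ := hF.1
      rw [Finset.mem_inter] at hx₀
      have hdiam : (D : ℝ) ≤ linkDiamZd X := le_linkDiamZd_of_far hx₀.2 hx₀.1 hF.2
      calc ∑ x ∈ vertexStarZd s,
            (if ((X ∩ vertexStarZd s).Nonempty ∧ ¬ X ⊆ starNbhdZdR D s) ∧ x ∈ X then lip X x else 0)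
          = ∑ x ∈ vertexStarZd s, (if x ∈ X then lip X x else 0) :=
            Finset.sum_congr rfl fun x _ => by
              by_cases hx : x ∈ X
              · rw [if_pos ⟨hF, hx⟩, if_pos hx]
              · rw [if_neg (fun h => hx h.2), if_neg hx]
        _ = ∑ x ∈ vertexStarZd s ∩ X, lip X x := by rw [Finset.sum_ite_mem]
        _ ≤ ∑ x ∈ X, lip X x :=
            Finset.sum_le_sum_of_subset_of_nonneg Finset.inter_subset_right fun x _ _ => (hlip X).nonneg x
        _ = Real.exp (-(κ * D)) * (Real.exp (κ * D) * ∑ x ∈ X, lip X x) := by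
            rw [← mul_assoc, ← Real.exp_add, neg_add_cancel, Real.exp_zero, one_mul]
        _ ≤ Real.exp (-(κ * D)) * (Real.exp (κ * linkDiamZd X) * ∑ y ∈ X, lip X y) := by
            refine mul_le_mul_of_nonneg_left (mul_le_mul_of_nonneg_right ?_ hs0) (Real.exp_nonneg _)
            exact Real.exp_le_exp.2 (mul_le_mul_of_nonneg_left hdiam hκ)
    · refine (Finset.sum_eq_zero fun x _ => by rw [if_neg (fun h => hF h.1)]).le.trans ?_
      exact mul_nonneg (Real.exp_nonneg _) (by split_ifs; exacts [mul_nonneg (Real.exp_nonneg _) hs0, le_rfl])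
  calc ∑' X, ∑ x ∈ vertexStarZd s,
        (if ((X ∩ vertexStarZd s).Nonempty ∧ ¬ X ⊆ starNbhdZdR D s) ∧ x ∈ X then lip X x else 0)
      ≤ ∑' X, Real.exp (-(κ * D)) *
          (if (X ∩ vertexStarZd s).Nonempty then Real.exp (κ * linkDiamZd X) * ∑ y ∈ X, lip X y else 0) :=
        (summable_sum fun x _ => hsx x).tsum_le_tsum hterm (hms.mul_left _)
    _ = Real.exp (-(κ * D)) * ∑' X,
          (if (X ∩ vertexStarZd s).Nonempty then Real.exp (κ * linkDiamZd X) * ∑ y ∈ X, lip X y else 0) :=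
        tsum_mul_left
    _ ≤ Real.exp (-(κ * D)) * (((d : ℝ) + 1) * ε₁) := mul_le_mul_of_nonneg_left hmb (Real.exp_nonneg _)
    _ = ((d : ℝ) + 1) * Real.exp (-(κ * D)) * ε₁ := by ring

/-- **The reach-weighted exterior constants**: with `L_y = Σ'_{FAR ∋ y, y ∉ ⋆} lip_X(y)` and the reach
`‖y.1 − s‖ + 1 ≤ diam X + 2` of a link of a set meeting the star, for `0 ≤ t ≤ κ`:
`y ↦ L_y e^{t(‖y.1 − s‖+1)}` is summable and `Σ'_y L_y e^{t(‖y.1−s‖+1)} ≤ (d+1) e^{2t} e^{−(κ−t)D} ε₁`. [folklore] -/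
theorem tsum_farExt_mul_exp_reach_le (hlip : ∀ X, IsLipBound suFrobDist (W X) (lip X))
    (hlips : ∀ v : Site d, Summable fun X : Finset (ZdEdge d) =>
      (if (∃ μ : Fin d, ((v, μ) : ZdEdge d) ∈ X) then Real.exp (κ * linkDiamZd X) * ∑ y ∈ X, lip X y else 0))
    (hlipa : ∀ v : Site d, ∑' X : Finset (ZdEdge d),
      (if (∃ μ : Fin d, ((v, μ) : ZdEdge d) ∈ X) then Real.exp (κ * linkDiamZd X) * ∑ y ∈ X, lip X y else 0) ≤ ε₁)
    {t : ℝ} (ht : 0 ≤ t) (htκ : t ≤ κ) (D : ℕ) (s : Site d) :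
    (Summable fun y : ZdEdge d => (∑' X : Finset (ZdEdge d),
        (if ((X ∩ vertexStarZd s).Nonempty ∧ ¬ X ⊆ starNbhdZdR D s) ∧ y ∈ X ∧ y ∉ vertexStarZd s
          then lip X y else 0)) * Real.exp (t * (‖y.1 - s‖ + 1))) ∧
    ∑' y : ZdEdge d, (∑' X : Finset (ZdEdge d),
        (if ((X ∩ vertexStarZd s).Nonempty ∧ ¬ X ⊆ starNbhdZdR D s) ∧ y ∈ X ∧ y ∉ vertexStarZd s
          then lip X y else 0)) * Real.exp (t * (‖y.1 - s‖ + 1)) ≤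
      ((d : ℝ) + 1) * Real.exp (2 * t) * Real.exp (-((κ - t) * D)) * ε₁ := by
  classical
  have hκ : 0 ≤ κ := ht.trans htκ
  obtain ⟨hms, hmb⟩ := tsum_meets_star_weighted_lip_le (κ := κ) (ε₁ := ε₁) hlip hlips hlipa s
  -- the nonnegative double family
  set G : Finset (ZdEdge d) → ZdEdge d → ℝ := fun X y =>
    if ((X ∩ vertexStarZd s).Nonempty ∧ ¬ X ⊆ starNbhdZdR D s) ∧ y ∈ X ∧ y ∉ vertexStarZd s
      then lip X y * Real.exp (t * (‖y.1 - s‖ + 1)) else 0 with hG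
  have hG0 : ∀ X y, 0 ≤ G X y := fun X y => by
    simp only [hG]; split_ifs; exacts [mul_nonneg ((hlip X).nonneg y) (Real.exp_nonneg _), le_rfl]
  have hFin : ∀ X, ∑' y, G X y = ∑ y ∈ X, G X y := fun X =>
    tsum_eq_sum (s := X) fun y hy => by simp only [hG]; rw [if_neg (fun h => hy h.2.1)]
  -- per set: `Σ_{y ∈ X} G X y ≤ e^{2t} e^{-(κ-t)D} · (weighted mass of X)`
  have hXle : ∀ X, ∑ y ∈ X, G X y ≤ Real.exp (2 * t) * Real.exp (-((κ - t) * D)) *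
      (if (X ∩ vertexStarZd s).Nonempty then Real.exp (κ * linkDiamZd X) * ∑ y ∈ X, lip X y else 0) := by
    intro X
    have hs0 : 0 ≤ ∑ y ∈ X, lip X y := Finset.sum_nonneg fun y _ => (hlip X).nonneg y
    by_cases hF : (X ∩ vertexStarZd s).Nonempty ∧ ¬ X ⊆ starNbhdZdR D s
    · rw [if_pos hF.1]
      obtain ⟨x₀, hx₀⟩ := hF.1
      rw [Finset.mem_inter] at hx₀
      have hdiam : (D : ℝ) ≤ linkDiamZd X := le_linkDiamZd_of_far hx₀.2 hx₀.1 hF.2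
      have hreach : ∀ y ∈ X, ‖y.1 - s‖ + 1 ≤ (linkDiamZd X : ℝ) + 2 := by
        intro y hy
        have h1 : ‖y.1 - x₀.1‖ ≤ (linkDiamZd X : ℝ) := norm_sub_le_linkDiamZd hy hx₀.1
        have h2 : ‖x₀.1 - s‖ ≤ 1 := norm_sub_le_one_of_mem_vertexStarZd hx₀.2
        have h3 : ‖y.1 - s‖ ≤ ‖y.1 - x₀.1‖ + ‖x₀.1 - s‖ := norm_sub_le_norm_sub_add_norm_sub _ _ _
        linarith
      have hexp : ∀ y ∈ X, Real.exp (t * (‖y.1 - s‖ + 1)) ≤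
          Real.exp (2 * t) * Real.exp (-((κ - t) * D)) * Real.exp (κ * linkDiamZd X) := by
        intro y hy
        rw [← Real.exp_add, ← Real.exp_add]
        refine Real.exp_le_exp.2 ?_
        have := mul_le_mul_of_nonneg_left (hreach y hy) ht
        have h4 : (κ - t) * (D : ℝ) ≤ (κ - t) * linkDiamZd X := mul_le_mul_of_nonneg_left hdiam (sub_nonneg.2 htκ)
        nlinarith
      calc ∑ y ∈ X, G X y ≤ ∑ y ∈ X, lip X y *
            (Real.exp (2 * t) * Real.exp (-((κ - t) * D)) * Real.exp (κ * linkDiamZd X)) := by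
            refine Finset.sum_le_sum fun y hy => ?_
            simp only [hG]
            split_ifs
            · exact mul_le_mul_of_nonneg_left (hexp y hy) ((hlip X).nonneg y)
            · exact mul_nonneg ((hlip X).nonneg y) (by positivity)
        _ = Real.exp (2 * t) * Real.exp (-((κ - t) * D)) * (Real.exp (κ * linkDiamZd X) * ∑ y ∈ X, lip X y) := by
            rw [← Finset.sum_mul]; ring
    · have h0 : ∑ y ∈ X, G X y = 0 := Finset.sum_eq_zero fun y _ => by
        simp only [hG]; rw [if_neg (fun h => hF h.1)]
      rw [h0]
      exact mul_nonneg (by positivity) (by split_ifs; exacts [mul_nonneg (Real.exp_nonneg _) hs0, le_rfl])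
  have hsumX : Summable fun X => ∑' y, G X y := by
    simp_rw [hFin]
    exact Summable.of_nonneg_of_le (fun X => Finset.sum_nonneg fun y _ => hG0 X y) hXle (hms.mul_left _)
  have hunc : Summable (Function.uncurry G) :=
    (summable_prod_of_nonneg fun p => hG0 p.1 p.2).2
      ⟨fun X => summable_of_ne_finset_zero (s := X) fun y hy => by
        show G X y = 0; simp only [hG]; rw [if_neg (fun h => hy h.2.1)], hsumX⟩
  -- summability in `y` of the `X`-sums (swap the product)
  have hswap : Summable fun p : ZdEdge d × Finset (ZdEdge d) => G p.2 p.1 := hunc.prod_symm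
  have hy : Summable fun y : ZdEdge d => ∑' X, G X y :=
    ((summable_prod_of_nonneg fun p => hG0 p.2 p.1).1 hswap).2
  -- identify the weighted exterior series with `Σ'_y Σ'_X G`
  have hident : ∀ y : ZdEdge d, (∑' X : Finset (ZdEdge d),
      (if ((X ∩ vertexStarZd s).Nonempty ∧ ¬ X ⊆ starNbhdZdR D s) ∧ y ∈ X ∧ y ∉ vertexStarZd s
        then lip X y else 0)) * Real.exp (t * (‖y.1 - s‖ + 1)) = ∑' X, G X y := by
    intro y
    rw [← tsum_mul_right]
    refine tsum_congr fun X => ?_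
    simp only [hG]
    split_ifs <;> simp
  simp_rw [hident]
  refine ⟨hy, ?_⟩
  rw [hunc.tsum_comm]
  calc ∑' X, ∑' y, G X y ≤ ∑' X, Real.exp (2 * t) * Real.exp (-((κ - t) * D)) *
        (if (X ∩ vertexStarZd s).Nonempty then Real.exp (κ * linkDiamZd X) * ∑ y ∈ X, lip X y else 0) := by
        refine hsumX.tsum_le_tsum (fun X => ?_) (hms.mul_left _)
        rw [hFin]; exact hXle X
    _ = Real.exp (2 * t) * Real.exp (-((κ - t) * D)) * ∑' X,
        (if (X ∩ vertexStarZd s).Nonempty then Real.exp (κ * linkDiamZd X) * ∑ y ∈ X, lip X y else 0) :=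
        tsum_mul_left
    _ ≤ Real.exp (2 * t) * Real.exp (-((κ - t) * D)) * (((d : ℝ) + 1) * ε₁) :=
        mul_le_mul_of_nonneg_left hmb (by positivity)
    _ = ((d : ℝ) + 1) * Real.exp (2 * t) * Real.exp (-((κ - t) * D)) * ε₁ := by ring

end Loads

/-! ### From the sitewise to the global window contraction -/

/-- **Sitewise + locality ⇒ global window contraction.** For a specification `γ` on the links of `ℤ^d`, a
centre `c`, a finite locality set `Nb` through which the star kernel reads its boundary condition (`hloc`), and
an array `K(y → x) ≥ 0` with the one-boundary-link contraction (`hsite`), changing the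
boundary links of `Nb` one at a time gives, for ALL exteriors `ω, η` and every bounded measurable star-local `f`
with link-Lipschitz vector `δ ≥ 0`:
`|γ_⋆ f(ω) − γ_⋆ f(η)| ≤ Σ_{x ∈ ⋆} δ x · Σ_{y ∈ Nb} K(y → x) r(ω_y, η_y)`. [folklore] -/
theorem window_contraction_global_of_sitewise {γ : Specification (ZdEdge d) (SUN N)} (hγ : IsSpecification γ)
    {r : SUN N → SUN N → ℝ} (hr0 : ∀ a b, 0 ≤ r a b) {c : ZdEdge d} {Nb : Finset (ZdEdge d)}
    {K : ZdEdge d → ZdEdge d → ℝ} (hK0 : ∀ y x, 0 ≤ K y x)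
    (hsite : ∀ y, y ∉ starWinZd c → ∀ (ω η : LGConfig d (SUN N)), (∀ v, v ≠ y → ω v = η v) →
      ∀ (f : LGConfig d (SUN N) → ℝ) (δ : ZdEdge d → ℝ), Measurable f → (∃ B, ∀ σ, |f σ| ≤ B) →
        DependsOn f (starWinZd c : Set (ZdEdge d)) → (∀ x, 0 ≤ δ x) →
        (∀ (x : ZdEdge d) (σ τ : LGConfig d (SUN N)), (∀ v, v ≠ x → σ v = τ v) →
          |f σ - f τ| ≤ δ x * r (σ x) (τ x)) →
          |∫ σ, f σ ∂(γ (starWinZd c) ω) - ∫ σ, f σ ∂(γ (starWinZd c) η)| ≤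
            (∑ x ∈ starWinZd c, K y x * δ x) * r (ω y) (η y))
    (hloc : ∀ (ζ ζ' : LGConfig d (SUN N)), (∀ v ∈ Nb, ζ v = ζ' v) →
      ∀ (f : LGConfig d (SUN N) → ℝ), Measurable f → (∃ B, ∀ σ, |f σ| ≤ B) →
        DependsOn f (starWinZd c : Set (ZdEdge d)) →
        ∫ σ, f σ ∂(γ (starWinZd c) ζ) = ∫ σ, f σ ∂(γ (starWinZd c) ζ'))
    (ω η : LGConfig d (SUN N)) {f : LGConfig d (SUN N) → ℝ} (hfm : Measurable f) (hfB : ∃ B, ∀ σ, |f σ| ≤ B)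
    (hfdep : DependsOn f (starWinZd c : Set (ZdEdge d))) {δ : ZdEdge d → ℝ} (hδ0 : ∀ x, 0 ≤ δ x)
    (hδ : ∀ (x : ZdEdge d) (σ τ : LGConfig d (SUN N)), (∀ v, v ≠ x → σ v = τ v) →
      |f σ - f τ| ≤ δ x * r (σ x) (τ x)) :
    |∫ σ, f σ ∂(γ (starWinZd c) ω) - ∫ σ, f σ ∂(γ (starWinZd c) η)| ≤
      ∑ x ∈ starWinZd c, δ x * ∑ y ∈ Nb, K y x * r (ω y) (η y) := by
  classical
  -- interpolating exteriors: `η` on `S`, `ω` elsewhere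
  have step : ∀ S : Finset (ZdEdge d), S ⊆ Nb →
      |∫ σ, f σ ∂(γ (starWinZd c) ω) - ∫ σ, f σ ∂(γ (starWinZd c) (S.piecewise η ω))| ≤
        ∑ x ∈ starWinZd c, δ x * ∑ y ∈ S, K y x * r (ω y) (η y) := by
    intro S
    induction S using Finset.induction_on with
    | empty =>
      intro _
      rw [Finset.piecewise_empty, sub_self, abs_zero]
      exact Finset.sum_nonneg fun x _ => mul_nonneg (hδ0 x) (by simp)
    | @insert y S hyS ih =>
      intro hsub
      have hS : S ⊆ Nb := fun z hz => hsub (Finset.mem_insert_of_mem hz)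
      have hdiff : ∀ v, v ≠ y → S.piecewise η ω v = (insert y S).piecewise η ω v := by
        intro v hv
        by_cases hvS : v ∈ S
        · rw [Finset.piecewise_eq_of_mem _ _ _ hvS, Finset.piecewise_eq_of_mem _ _ _ (Finset.mem_insert_of_mem hvS)]
        · rw [Finset.piecewise_eq_of_notMem _ _ _ hvS, Finset.piecewise_eq_of_notMem _ _ _
            (fun h => (Finset.mem_insert.1 h).elim hv hvS)]
      -- the one-link step
      have hone : |∫ σ, f σ ∂(γ (starWinZd c) (S.piecewise η ω)) -
          ∫ σ, f σ ∂(γ (starWinZd c) ((insert y S).piecewise η ω))| ≤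
          ∑ x ∈ starWinZd c, δ x * (K y x * r (ω y) (η y)) := by
        by_cases hy : y ∈ starWinZd c
        · -- a link of the window: the kernel does not see it
          rw [DobrushinShlosman.spec_apply_congr hγ (starWinZd c) (ω := S.piecewise η ω)
            (η := (insert y S).piecewise η ω) (fun v hv => hdiff v fun hvy => hv (hvy ▸ hy)), sub_self, abs_zero]
          exact Finset.sum_nonneg fun x _ => mul_nonneg (hδ0 x) (mul_nonneg (hK0 y x) (hr0 _ _))
        · have h := hsite y hy _ _ hdiff f δ hfm hfB hfdep hδ0 hδ
          rw [Finset.piecewise_eq_of_notMem _ _ _ hyS,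
            Finset.piecewise_eq_of_mem _ _ _ (Finset.mem_insert_self y S)] at h
          refine h.trans (le_of_eq ?_)
          rw [Finset.sum_mul]
          exact Finset.sum_congr rfl fun x _ => by ring
      calc |∫ σ, f σ ∂(γ (starWinZd c) ω) - ∫ σ, f σ ∂(γ (starWinZd c) ((insert y S).piecewise η ω))|
          ≤ |∫ σ, f σ ∂(γ (starWinZd c) ω) - ∫ σ, f σ ∂(γ (starWinZd c) (S.piecewise η ω))| +
            |∫ σ, f σ ∂(γ (starWinZd c) (S.piecewise η ω)) -
              ∫ σ, f σ ∂(γ (starWinZd c) ((insert y S).piecewise η ω))| := abs_sub_le _ _ _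
        _ ≤ ∑ x ∈ starWinZd c, δ x * ∑ z ∈ S, K z x * r (ω z) (η z) +
            ∑ x ∈ starWinZd c, δ x * (K y x * r (ω y) (η y)) := add_le_add (ih hS) hone
        _ = ∑ x ∈ starWinZd c, δ x * ∑ z ∈ insert y S, K z x * r (ω z) (η z) := by
            rw [← Finset.sum_add_distrib]
            refine Finset.sum_congr rfl fun x _ => ?_
            rw [Finset.sum_insert hyS]; ring
  have hfin := step Nb le_rfl
  rwa [hloc (Nb.piecewise η ω) η (fun v hv => Finset.piecewise_eq_of_mem _ _ _ hv) f hfm hfB hfdep] at hfin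

end Summit.Ventures.YMGap.RobustBall

end
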